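import Summits.CriticalPhenomena.PercolationContinuityZ3.Theses.PercMinContact
import Literature.Probability.Percolation.MeanFieldBetaFromGamma

/-!
# Route `PercMinContact`, item `TwoArmGlue` (stmt-CriticalPhenomena-11503) — `TwoArmWindow → SwallowTail`

The min-contact function of bond percolation on `ℤ³` at level `u` is
`m(u) = E_u[Σ_{y ∼ 0} min(|C(0)|, |C(y)|) · 1{0 ↮ y}]` (cluster sizes in `ℕ∞`, expectation in `[0, ∞]`).
`TwoArmWindow` supplies `0 ≤ λ < 1`, `Δ₀ > 0` with `Δ₀ (1 - λ) < 1`, `c > 0` and `C` with, for every level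
`u < p_c`,

* (a) `Σ_{y ∼ 0} P_u(|C(0)| ≥ n, |C(y)| ≥ n, 0 ↮ y) ≤ C n^{-λ}` (`n ≥ 1`), and
* (b) `P_u(|C(0)| ≥ n) ≤ C exp(-c n (p_c - u)^{Δ₀})` (all `n`).

`SwallowTail` asks for some `p < p_c` with `∫_{(p, p_c)} m(u) du < ∞`; we take `p = 0` (`p_c > 0`,
Grimmett 1999 §1.4, proved in the tree).

Proof.
1. Layer cake in `ℕ∞`: `min(a, b) = Σ_{n ≥ 1} 1{a ≥ n} 1{b ≥ n}` (`min_toENNReal_eq_tsum`), so by Tonelli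
   (the events are measurable: `measurableSet_clusterSizeGe`, `measurableSet_openConn_holds`)
   `m(u) ≤ Σ_{n ≥ 1} T_n(u)`, `T_n(u) = Σ_{y ∼ 0} P_u(|C(0)| ≥ n, |C(y)| ≥ n, 0 ↮ y)`
   (`lintegral_sum_indicator_min_le`).
2. By (a) and (b), `T_n(u) ≤ min(C n^{-λ}, D exp(-c n (p_c - u)^{Δ₀}))` with `D = 6C` (`6 = #` neighbours).
3. Real analysis (`lintegral_tsum_min_lt_top`): pick `ρ` with `1 - λ < ρ < 1/Δ₀` (possible exactly because
   `Δ₀ (1 - λ) < 1`) and put `κ = 1 - ρ Δ₀ > 0`. For each `n`, integrate in `u` FIRST: on the window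
   `p_c - u < n^{-ρ}` use the first bound (contribution `≤ C n^{-λ-ρ}`), elsewhere `(p_c - u)^{Δ₀} ≥ n^{-ρΔ₀}`
   so the second bound is `≤ D exp(-c n^{κ}) ≤ D m!/(c n^{κ})^m` (contribution `≤ p_c D m! c^{-m} n^{-κ m}`,
   `m ∈ ℕ` with `κ m > 1`). Both are summable `p`-series (`λ + ρ > 1`, `κ m > 1`), so by Tonelli again
   `∫_{(0,p_c)} m ≤ Σ_n ∫_{(0,p_c)} min(…) < ∞`.

This replaces the split at `N ≍ s^{-Δ₀} log(1/s)` of the item's informal proof by a per-`n` split in the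
level, which avoids partial power sums and logarithms; the exponent bookkeeping (`Δ₀(1-λ) < 1`) is the same.

References: T. Hutchcroft, *Power-law bounds for critical long-range percolation …* / *New critical exponent
inequalities for percolation and the random cluster model* (2021), §3 (two-arm volume bounds, context only);
G. Grimmett, *Percolation* (1999), §1.4 (`0 < p_c < 1`), §5.3.
-/

namespace Summit.CriticalPhenomena.PercolationContinuityZ3.Theorems

open MeasureTheory Set Filter
open scoped ENNReal BigOperators
open Literature.Probability.Percolation Literature.Probability.LatticeModels

/-! ### Layer cake in `ℕ∞` -/

/-- Layer cake for an extended natural number: `m = Σ_{k ≥ 0} 1{k + 1 ≤ m}` in `[0, ∞]`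
(for `m = ⊤` both sides are `∞`). [folklore] -/
theorem toENNReal_eq_tsum_ite (m : ℕ∞) :
    (m : ℝ≥0∞) = ∑' k : ℕ, (if ((k + 1 : ℕ) : ℕ∞) ≤ m then (1 : ℝ≥0∞) else 0) := by
  induction m using ENat.recTopCoe with
  | top =>
    simp only [le_top, if_true, ENat.toENNReal_top]
    exact (ENNReal.tsum_const_eq_top_of_ne_zero one_ne_zero).symm
  | coe m =>
    rw [ENat.toENNReal_coe, tsum_eq_sum (s := Finset.range m)]
    · rw [Finset.sum_congr rfl (g := fun _ => (1 : ℝ≥0∞))]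
      · simp
      · intro k hk
        rw [Finset.mem_range] at hk
        rw [if_pos (by exact_mod_cast hk)]
    · intro k hk
      rw [Finset.mem_range, not_lt] at hk
      rw [if_neg]
      exact_mod_cast (by omega : ¬ (k + 1 ≤ m))

/-- Two-variable layer cake: `min(a, b) = Σ_{k ≥ 0} 1{k + 1 ≤ a} 1{k + 1 ≤ b}` in `[0, ∞]` for
`a, b ∈ ℕ∞`. [folklore] -/
theorem min_toENNReal_eq_tsum (a b : ℕ∞) :
    min (a : ℝ≥0∞) (b : ℝ≥0∞) =
      ∑' k : ℕ, (if ((k + 1 : ℕ) : ℕ∞) ≤ a ∧ ((k + 1 : ℕ) : ℕ∞) ≤ b then (1 : ℝ≥0∞) else 0) := by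
  rw [← ENat.toENNReal_min, toENNReal_eq_tsum_ite]
  simp only [le_min_iff]

/-! ### Step 1: the expectation bound (layer cake + Tonelli) -/

/-- **Layer-cake bound for the min-contact functional.** For bond percolation on any graph with countably
many vertices, any vertex `x` and any finite set `N` of vertices,
`E_p[Σ_{y ∈ N} 1{x ↮ y} min(|C(x)|, |C(y)|)] ≤ Σ_{k ≥ 0} Σ_{y ∈ N} P_p(|C(x)| ≥ k+1, |C(y)| ≥ k+1, x ↮ y)`
(in fact equality; Tonelli for the measurable events `{|C(·)| ≥ n}` and `{x ↔ y}`). [folklore] -/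
theorem lintegral_sum_indicator_min_le {V : Type*} [Countable V] (G : SimpleGraph V)
    (p : unitInterval) (x : V) (N : Finset V) :
    ∫⁻ ω, ∑ y ∈ N, (openConn x y)ᶜ.indicator
        (fun ω => min ((openCluster ω x).encard : ℝ≥0∞) ((openCluster ω y).encard : ℝ≥0∞)) ω
      ∂(bondPercolation G p) ≤
    ∑' k : ℕ, ∑ y ∈ N, bondPercolation G p
      {ω | ((k + 1 : ℕ) : ℕ∞) ≤ (openCluster ω x).encard ∧
        ((k + 1 : ℕ) : ℕ∞) ≤ (openCluster ω y).encard ∧ ¬ (openGraph ω).Reachable x y} := by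
  classical
  set E : V → ℕ → Set (BondConfig V) := fun y k =>
    {ω | ((k + 1 : ℕ) : ℕ∞) ≤ (openCluster ω x).encard ∧
        ((k + 1 : ℕ) : ℕ∞) ≤ (openCluster ω y).encard ∧ ¬ (openGraph ω).Reachable x y} with hE
  have hEmeas : ∀ y k, MeasurableSet (E y k) := by
    intro y k
    have : E y k = clusterSizeGe x (k + 1) ∩ clusterSizeGe y (k + 1) ∩ (openConn x y)ᶜ := by
      ext ω
      simp only [hE, Set.mem_setOf_eq, Set.mem_inter_iff, mem_clusterSizeGe, Set.mem_compl_iff, openConn,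
        and_assoc]
    rw [this]
    exact ((measurableSet_clusterSizeGe x _).inter (measurableSet_clusterSizeGe y _)).inter
      (measurableSet_openConn_holds x y).compl
  -- pointwise layer cake
  have hpt : ∀ ω y, (openConn x y)ᶜ.indicator
      (fun ω => min ((openCluster ω x).encard : ℝ≥0∞) ((openCluster ω y).encard : ℝ≥0∞)) ω
      ≤ ∑' k : ℕ, (E y k).indicator (fun _ => (1 : ℝ≥0∞)) ω := by
    intro ω y
    by_cases hω : ω ∈ openConn x y
    · rw [Set.indicator_of_notMem (by simpa using hω)]
      exact bot_le
    · rw [Set.indicator_of_mem (Set.mem_compl hω), min_toENNReal_eq_tsum]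
      refine le_of_eq (tsum_congr fun k => ?_)
      have hr : ¬ (openGraph ω).Reachable x y := hω
      simp only [Set.indicator, hE, Set.mem_setOf_eq, hr, not_false_eq_true, and_true]
  calc ∫⁻ ω, ∑ y ∈ N, (openConn x y)ᶜ.indicator
        (fun ω => min ((openCluster ω x).encard : ℝ≥0∞) ((openCluster ω y).encard : ℝ≥0∞)) ω
        ∂(bondPercolation G p)
      ≤ ∫⁻ ω, ∑ y ∈ N, ∑' k : ℕ, (E y k).indicator (fun _ => (1 : ℝ≥0∞)) ω ∂(bondPercolation G p) :=
        lintegral_mono fun ω => Finset.sum_le_sum fun y _ => hpt ω y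
    _ = ∑ y ∈ N, ∑' k : ℕ, bondPercolation G p (E y k) := by
        rw [lintegral_finsetSum]
        · refine Finset.sum_congr rfl fun y _ => ?_
          rw [lintegral_tsum]
          · refine tsum_congr fun k => ?_
            rw [lintegral_indicator_const (hEmeas y k), one_mul]
          · exact fun k => (measurable_const.indicator (hEmeas y k)).aemeasurable
        · intro y _
          exact Measurable.tsum fun k => measurable_const.indicator (hEmeas y k)
    _ = ∑' k : ℕ, ∑ y ∈ N, bondPercolation G p (E y k) :=
        (Summable.tsum_finsetSum fun _ _ => ENNReal.summable).symm

/-! ### Step 3: the real-analysis lemma -/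

/-- **The window sum is integrable.** If `λ < 1`, `Δ₀ > 0`, `Δ₀ (1 - λ) < 1`, `c > 0`, `C, D ≥ 0` and
`p_c > 0`, then `∫_{(0, p_c)} Σ_{n ≥ 1} min(C n^{-λ}, D exp(-c n (p_c - u)^{Δ₀})) du < ∞`.
Proof: choose `1 - λ < ρ < 1/Δ₀`, split the level integral of the `n`-th term at `p_c - u = n^{-ρ}`,
bound `exp(-c n^{κ}) ≤ m!/(c n^{κ})^m` (`κ = 1 - ρ Δ₀`, `κ m > 1`) and sum two `p`-series. [folklore] -/
theorem lintegral_tsum_min_lt_top {lam Δ₀ C c D pc : ℝ} (hlam : lam < 1) (hΔ₀ : 0 < Δ₀)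
    (hΔl : Δ₀ * (1 - lam) < 1) (hc : 0 < c) (hC : 0 ≤ C) (hD : 0 ≤ D) (hpc : 0 < pc) :
    ∫⁻ u in Set.Ioo 0 pc, ∑' k : ℕ,
        min (ENNReal.ofReal (C * ((k + 1 : ℕ) : ℝ) ^ (-lam)))
          (ENNReal.ofReal (D * Real.exp (-(c * ((k + 1 : ℕ) : ℝ) * (pc - u) ^ Δ₀)))) < ⊤ := by
  -- elementary: `exp(-x) ≤ m! / x^m` for `x > 0` (from `x^m/m! ≤ exp x`)
  have hexp : ∀ {x : ℝ}, 0 < x → ∀ m : ℕ, Real.exp (-x) ≤ (m.factorial : ℝ) / x ^ m := by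
    intro x hx m
    have h := Real.pow_div_factorial_le_exp x hx.le m
    have hfac : (0 : ℝ) < m.factorial := by exact_mod_cast Nat.factorial_pos m
    rw [Real.exp_neg, inv_eq_one_div, div_le_div_iff₀ (Real.exp_pos x) (pow_pos hx m), one_mul]
    rw [div_le_iff₀ hfac] at h
    linarith
  -- choice of exponents
  have hkey : 1 - lam < 1 / Δ₀ := by
    rw [lt_div_iff₀ hΔ₀]; linarith [mul_comm Δ₀ (1 - lam)]
  set ρ : ℝ := ((1 - lam) + 1 / Δ₀) / 2 with hρ_def
  have hρ1 : 1 - lam < ρ := by rw [hρ_def]; linarith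
  have hρ0 : 0 < ρ := by linarith
  have hρ2 : ρ * Δ₀ < 1 := by
    have h1 : ρ < 1 / Δ₀ := by rw [hρ_def]; linarith
    have := (lt_div_iff₀ hΔ₀).1 h1
    linarith
  set κ : ℝ := 1 - ρ * Δ₀ with hκ_def
  have hκ : 0 < κ := by rw [hκ_def]; linarith
  obtain ⟨m, hm⟩ : ∃ m : ℕ, 1 < κ * m := by
    obtain ⟨m, hm⟩ := exists_nat_gt (1 / κ)
    exact ⟨m, by rwa [div_lt_iff₀' hκ] at hm⟩
  -- the two summable majorants
  set f₁ : ℕ → ℝ := fun k => C * ((k + 1 : ℕ) : ℝ) ^ (-(lam + ρ)) with hf₁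
  set f₂ : ℕ → ℝ := fun k =>
    D * ((m.factorial : ℝ) / c ^ m) * ((k + 1 : ℕ) : ℝ) ^ (-(κ * m)) * pc with hf₂
  have hf₁nn : ∀ k, 0 ≤ f₁ k := fun k => by
    rw [hf₁]; exact mul_nonneg hC (Real.rpow_nonneg (Nat.cast_nonneg _) _)
  have hf₂nn : ∀ k, 0 ≤ f₂ k := fun k => by
    rw [hf₂]
    refine mul_nonneg (mul_nonneg (mul_nonneg hD ?_) (Real.rpow_nonneg (Nat.cast_nonneg _) _)) hpc.le
    positivity
  have hsum : ∀ e : ℝ, e < -1 → Summable fun k : ℕ => ((k + 1 : ℕ) : ℝ) ^ e := fun e he =>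
    (summable_nat_add_iff 1).2 (Real.summable_nat_rpow.2 he)
  have hf₁s : Summable f₁ := (hsum _ (by linarith)).mul_left C
  have hf₂s : Summable f₂ := by
    have := ((hsum (-(κ * m)) (by linarith)).mul_left (D * ((m.factorial : ℝ) / c ^ m))).mul_right pc
    simpa [hf₂] using this
  -- per-term level integral
  have hterm : ∀ k : ℕ,
      ∫⁻ u in Set.Ioo 0 pc, min (ENNReal.ofReal (C * ((k + 1 : ℕ) : ℝ) ^ (-lam)))
          (ENNReal.ofReal (D * Real.exp (-(c * ((k + 1 : ℕ) : ℝ) * (pc - u) ^ Δ₀))))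
        ≤ ENNReal.ofReal (f₁ k) + ENNReal.ofReal (f₂ k) := by
    intro k
    set n : ℝ := ((k + 1 : ℕ) : ℝ) with hn_def
    have hn1 : 1 ≤ n := by rw [hn_def]; exact_mod_cast Nat.succ_le_succ (Nat.zero_le k)
    have hn0 : 0 < n := by linarith
    set t : ℝ := n ^ (-ρ) with ht_def
    have ht0 : 0 < t := Real.rpow_pos_of_pos hn0 _
    set A : ℝ≥0∞ := ENNReal.ofReal (C * n ^ (-lam)) with hA_def
    set B : ℝ≥0∞ := ENNReal.ofReal (D * Real.exp (-(c * n ^ κ))) with hB_def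
    -- pointwise split at `pc - u = t`
    have hpt : ∀ u ∈ Set.Ioo (0 : ℝ) pc,
        min A (ENNReal.ofReal (D * Real.exp (-(c * n * (pc - u) ^ Δ₀))))
          ≤ (Set.Ioi (pc - t)).indicator (fun _ => A) u + B := by
      intro u hu
      by_cases hut : pc - t < u
      · rw [Set.indicator_of_mem (show u ∈ Set.Ioi (pc - t) from hut)]
        exact (min_le_left _ _).trans le_self_add
      · have hs : t ≤ pc - u := by linarith
        have hs0 : 0 < pc - u := by linarith [hu.2]
        refine (min_le_right _ _).trans (le_add_left ?_)
        rw [hB_def]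
        refine ENNReal.ofReal_le_ofReal (mul_le_mul_of_nonneg_left ?_ hD)
        refine Real.exp_le_exp.2 (neg_le_neg ?_)
        have htpow : t ^ Δ₀ ≤ (pc - u) ^ Δ₀ := Real.rpow_le_rpow ht0.le hs hΔ₀.le
        have hnk : n ^ κ = n * t ^ Δ₀ := by
          rw [ht_def, ← Real.rpow_mul hn0.le, hκ_def, sub_eq_add_neg, Real.rpow_add hn0, Real.rpow_one,
            neg_mul]
        rw [hnk, mul_assoc]
        exact mul_le_mul_of_nonneg_left (mul_le_mul_of_nonneg_left htpow hn0.le) hc.le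
    -- integrate the split bound
    have hmeasI : MeasurableSet (Set.Ioi (pc - t)) := measurableSet_Ioi
    calc ∫⁻ u in Set.Ioo 0 pc, min A (ENNReal.ofReal (D * Real.exp (-(c * n * (pc - u) ^ Δ₀))))
        ≤ ∫⁻ u in Set.Ioo 0 pc, ((Set.Ioi (pc - t)).indicator (fun _ => A) u + B) :=
          setLIntegral_mono' measurableSet_Ioo hpt
      _ = A * volume (Set.Ioi (pc - t) ∩ Set.Ioo 0 pc) + B * volume (Set.Ioo (0 : ℝ) pc) := by
          rw [lintegral_add_right _ measurable_const, lintegral_indicator_const hmeasI, setLIntegral_const,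
            Measure.restrict_apply hmeasI]
      _ ≤ A * ENNReal.ofReal t + B * ENNReal.ofReal pc := by
          gcongr
          · calc volume (Set.Ioi (pc - t) ∩ Set.Ioo 0 pc) ≤ volume (Set.Ioo (pc - t) pc) :=
                  measure_mono fun u hu => ⟨hu.1, hu.2.2⟩
              _ = ENNReal.ofReal t := by rw [Real.volume_Ioo]; congr 1; ring
          · rw [Real.volume_Ioo, sub_zero]
      _ ≤ ENNReal.ofReal (f₁ k) + ENNReal.ofReal (f₂ k) := by
          gcongr
          · -- first window: `C n^{-λ} · n^{-ρ} = C n^{-(λ+ρ)}`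
            rw [hA_def, ← ENNReal.ofReal_mul' ht0.le, hf₁]
            refine le_of_eq ?_
            congr 1
            rw [ht_def, mul_assoc, ← Real.rpow_add hn0, neg_add]
          · -- second window: `exp(-c n^κ) ≤ m!/(c n^κ)^m`
            rw [hB_def, ← ENNReal.ofReal_mul' hpc.le, hf₂]
            refine ENNReal.ofReal_le_ofReal (mul_le_mul_of_nonneg_right ?_ hpc.le)
            rw [mul_assoc]
            refine mul_le_mul_of_nonneg_left ?_ hD
            have hx : 0 < c * n ^ κ := mul_pos hc (Real.rpow_pos_of_pos hn0 _)
            calc Real.exp (-(c * n ^ κ)) ≤ (m.factorial : ℝ) / (c * n ^ κ) ^ m :=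
                  hexp hx m
              _ = (m.factorial : ℝ) / c ^ m * n ^ (-(κ * m)) := by
                  rw [mul_pow, ← Real.rpow_mul_natCast hn0.le, Real.rpow_neg hn0.le]
                  ring
  -- measurability of the terms in the level `u`
  have hmeas : ∀ k : ℕ, Measurable fun u : ℝ =>
      min (ENNReal.ofReal (C * ((k + 1 : ℕ) : ℝ) ^ (-lam)))
        (ENNReal.ofReal (D * Real.exp (-(c * ((k + 1 : ℕ) : ℝ) * (pc - u) ^ Δ₀)))) := by
    intro k
    refine Measurable.min measurable_const (ENNReal.measurable_ofReal.comp ?_)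
    exact ((((measurable_const.sub measurable_id).pow_const Δ₀).const_mul _).neg.exp).const_mul D
  -- Tonelli and the two `p`-series
  rw [lintegral_tsum fun k => (hmeas k).aemeasurable]
  calc ∑' k : ℕ, ∫⁻ u in Set.Ioo 0 pc, min (ENNReal.ofReal (C * ((k + 1 : ℕ) : ℝ) ^ (-lam)))
          (ENNReal.ofReal (D * Real.exp (-(c * ((k + 1 : ℕ) : ℝ) * (pc - u) ^ Δ₀))))
      ≤ ∑' k : ℕ, (ENNReal.ofReal (f₁ k) + ENNReal.ofReal (f₂ k)) := ENNReal.tsum_le_tsum hterm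
    _ = ENNReal.ofReal (∑' k, f₁ k) + ENNReal.ofReal (∑' k, f₂ k) := by
        rw [ENNReal.tsum_add, ENNReal.ofReal_tsum_of_nonneg hf₁nn hf₁s,
          ENNReal.ofReal_tsum_of_nonneg hf₂nn hf₂s]
    _ < ⊤ := ENNReal.add_lt_top.2 ⟨ENNReal.ofReal_lt_top, ENNReal.ofReal_lt_top⟩

/-! ### The item -/

/-- **Item `stmt-CriticalPhenomena-11503` (`PercMinContact.TwoArmGlue`), proved:** the factorised engine
`TwoArmWindow` (a `p`-uniform volume two-arm bound `Σ_{y∼0} P_u(|C(0)| ≥ n, |C(y)| ≥ n, 0 ↮ y) ≤ C n^{-λ}`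
plus a subcritical volume window `P_u(|C(0)| ≥ n) ≤ C e^{-c n (p_c-u)^{Δ₀}}` with `Δ₀ (1 - λ) < 1`) implies
`SwallowTail` (integrability of the min-contact function `m(u)` on `(0, p_c)`): layer cake + Tonelli give
`m(u) ≤ Σ_n min(C n^{-λ}, 6C e^{-c n (p_c-u)^{Δ₀}})`, and integrating each term in the level first
(split at `p_c - u = n^{-ρ}`, `1 - λ < ρ < 1/Δ₀`) leaves two convergent `p`-series. [folklore] -/
theorem twoArmGlue_proof :
    Summit.CriticalPhenomena.PercolationContinuityZ3.Theses.PercMinContact.TwoArmGlue := by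
  unfold Summit.CriticalPhenomena.PercolationContinuityZ3.Theses.PercMinContact.TwoArmGlue
    Summit.CriticalPhenomena.PercolationContinuityZ3.Theses.PercMinContact.TwoArmWindow
    Summit.CriticalPhenomena.PercolationContinuityZ3.Theses.PercMinContact.SwallowTail
  rintro ⟨lam, Δ₀, C, c, -, hlam1, hΔ₀, hΔl, hc, hA, hB⟩
  have hpc := Grimmett1999_criticalProb_pos_lt_one_holds 3 (by norm_num)
  set pc : ℝ := criticalProb (zdGraph 3) (0 : Site 3) with hpc_def
  refine ⟨0, hpc.1, ?_⟩
  set N : Finset (Site 3) := (zdGraph 3).neighborFinset (0 : Site 3) with hN_def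
  -- `C ≥ 1 ≥ 0` from (b) at level `0`, `n = 0`
  have hC : 0 ≤ C := by
    have h := hB 0 (by simpa using hpc.1) 0
    simp only [Nat.cast_zero, zero_le, Set.setOf_true, probReal_univ, mul_zero, zero_mul,
      neg_zero, Real.exp_zero, mul_one] at h
    linarith
  set D : ℝ := (N.card : ℝ) * C with hD_def
  have hD : 0 ≤ D := mul_nonneg (Nat.cast_nonneg _) hC
  -- pointwise bound on `m(u)` for `0 < u < p_c`
  have hpt : ∀ u ∈ Set.Ioo (0 : ℝ) pc,
      (∫⁻ ω, ∑ y ∈ N, (openConn (0 : Site 3) y)ᶜ.indicator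
          (fun ω => min ((openCluster ω 0).encard : ℝ≥0∞) ((openCluster ω y).encard : ℝ≥0∞)) ω
        ∂(bondPercolation (zdGraph 3) (Set.projIcc (0 : ℝ) 1 zero_le_one u))) ≤
      ∑' k : ℕ, min (ENNReal.ofReal (C * ((k + 1 : ℕ) : ℝ) ^ (-lam)))
        (ENNReal.ofReal (D * Real.exp (-(c * ((k + 1 : ℕ) : ℝ) * (pc - u) ^ Δ₀)))) := by
    intro u hu
    have hu1 : u ∈ Set.Icc (0 : ℝ) 1 := ⟨hu.1.le, (hu.2.trans hpc.2).le⟩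
    rw [Set.projIcc_of_mem _ hu1]
    set q : unitInterval := ⟨u, hu1⟩ with hq_def
    have hq : (q : ℝ) < pc := hu.2
    have hqu : (q : ℝ) = u := rfl
    refine (lintegral_sum_indicator_min_le (zdGraph 3) q 0 N).trans (ENNReal.tsum_le_tsum fun k => ?_)
    refine le_min ?_ ?_
    · -- hypothesis (a) at `n = k + 1`
      have h := hA q hq (k + 1) (Nat.succ_le_succ (Nat.zero_le k))
      calc ∑ y ∈ N, bondPercolation (zdGraph 3) q
            {ω | ((k + 1 : ℕ) : ℕ∞) ≤ (openCluster ω 0).encard ∧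
              ((k + 1 : ℕ) : ℕ∞) ≤ (openCluster ω y).encard ∧ ¬ (openGraph ω).Reachable 0 y}
          = ENNReal.ofReal (∑ y ∈ N, (bondPercolation (zdGraph 3) q).real
            {ω | ((k + 1 : ℕ) : ℕ∞) ≤ (openCluster ω 0).encard ∧
              ((k + 1 : ℕ) : ℕ∞) ≤ (openCluster ω y).encard ∧ ¬ (openGraph ω).Reachable 0 y}) := by
            rw [ENNReal.ofReal_sum_of_nonneg fun y _ => measureReal_nonneg]
            exact Finset.sum_congr rfl fun y _ => (ofReal_measureReal (measure_ne_top _ _)).symm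
        _ ≤ ENNReal.ofReal (C * ((k + 1 : ℕ) : ℝ) ^ (-lam)) := ENNReal.ofReal_le_ofReal h
    · -- hypothesis (b) at `n = k + 1`, summed over the `#N` neighbours
      have h := hB q hq (k + 1)
      rw [hqu] at h
      calc ∑ y ∈ N, bondPercolation (zdGraph 3) q
            {ω | ((k + 1 : ℕ) : ℕ∞) ≤ (openCluster ω 0).encard ∧
              ((k + 1 : ℕ) : ℕ∞) ≤ (openCluster ω y).encard ∧ ¬ (openGraph ω).Reachable 0 y}
          ≤ ∑ y ∈ N, bondPercolation (zdGraph 3) q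
              {ω | ((k + 1 : ℕ) : ℕ∞) ≤ (openCluster ω 0).encard} :=
            Finset.sum_le_sum fun y _ => measure_mono fun ω hω => hω.1
        _ = (N.card : ℝ≥0∞) * ENNReal.ofReal ((bondPercolation (zdGraph 3) q).real
              {ω | ((k + 1 : ℕ) : ℕ∞) ≤ (openCluster ω 0).encard}) := by
            rw [Finset.sum_const, nsmul_eq_mul, ofReal_measureReal (measure_ne_top _ _)]
        _ ≤ (N.card : ℝ≥0∞) *
              ENNReal.ofReal (C * Real.exp (-(c * ((k + 1 : ℕ) : ℝ) * (pc - u) ^ Δ₀))) := by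
            gcongr
        _ = ENNReal.ofReal (D * Real.exp (-(c * ((k + 1 : ℕ) : ℝ) * (pc - u) ^ Δ₀))) := by
            rw [hD_def, mul_assoc (N.card : ℝ), ENNReal.ofReal_mul (Nat.cast_nonneg _), ENNReal.ofReal_natCast]
  calc ∫⁻ u in Set.Ioo 0 pc, ∫⁻ ω, ∑ y ∈ N, (openConn (0 : Site 3) y)ᶜ.indicator
          (fun ω => min ((openCluster ω 0).encard : ℝ≥0∞) ((openCluster ω y).encard : ℝ≥0∞)) ω
        ∂(bondPercolation (zdGraph 3) (Set.projIcc (0 : ℝ) 1 zero_le_one u))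
      ≤ ∫⁻ u in Set.Ioo 0 pc, ∑' k : ℕ, min (ENNReal.ofReal (C * ((k + 1 : ℕ) : ℝ) ^ (-lam)))
          (ENNReal.ofReal (D * Real.exp (-(c * ((k + 1 : ℕ) : ℝ) * (pc - u) ^ Δ₀)))) :=
        setLIntegral_mono' measurableSet_Ioo hpt
    _ < ⊤ := lintegral_tsum_min_lt_top hlam1 hΔ₀ hΔl hc hC hD hpc.1

end Summit.CriticalPhenomena.PercolationContinuityZ3.Theorems
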